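import Literature.Computability.Cryptography.PseudorandomGeneratorsAnyOWF
import Literature.Computability.Cryptography.SchemesOneTimeOWF
import Literature.Computability.Cryptography.SchemesSKESignatures
import Literature.Computability.Cryptography.TreeSigInstance
import HarnessLib

/-!
# Discharges of named facts of `Schemes.lean`

`Literature/Computability/Cryptography/SchemesDischarges.lean` — proofs-only sibling of
`Schemes.lean` (no definitions, no named facts). Each theorem below closes a named fact `X :
Prop` of that file as `X_holds : X` by composing an ACCEPTED reduction theorem of the tree
with the ACCEPTED unconditional `_holds` discharges of all of its hypotheses; nothing is
re-proved and no statement is changed. Recorded by the librarian sweep g25 (2026-08-16, pass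
5c: facts dischargeable in one line from the tree's own lemmas), so that the facts census,
`#h21_route_deps` and the cone guardrail see these facts as theorems.

Discharged here:

* `secureSignaturesExist_iff_OWFExist_holds` := `secureSignaturesExist_iff_OWFExist_of_rompel`
  `PRGExist_iff_OWFExist_holds)` (`SchemesOneTimeOWF.lean`).
* `secureSignaturesExist_of_secureSKEExist_holds` :=
  `secureSignaturesExist_of_secureSKEExist_of_OWF` `PRGExist_iff_OWFExist_holds)`
  (`SchemesSKESignatures.lean`).

## References

* [ImpagliazzoLuby1989] — see `lean/references.bib` and the docstring of the fact in `Schemes.lean`.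
* [Rompel1990] — see `lean/references.bib` and the docstring of the fact in `Schemes.lean`.
-/

namespace Literature.Computability.Cryptography

/-- **Discharge of the named fact `secureSignaturesExist_iff_OWFExist`** (`Schemes.lean`):
crypto-foundations.S23 (equivalence). Secure signature schemes exist if and only if one-way
functions exist. [Rompel 1990 (title theorem); Goldreich 2004, Thm. 6.4.1] — obtained as
`secureSignaturesExist_iff_OWFExist_of_rompel` applied to the tree's unconditional discharge
`PRGExist_iff_OWFExist_holds)` of its hypothesis (reduction in `SchemesOneTimeOWF.lean`).
[cite: Rompel1990, (title theorem] -/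
theorem secureSignaturesExist_iff_OWFExist_holds :
    secureSignaturesExist_iff_OWFExist :=
  secureSignaturesExist_iff_OWFExist_of_rompel
    (Literature.Computability.Cryptography.secureSignaturesExist_of_OWFExist_of_HILL Literature.Computability.Cryptography.PRGExist_iff_OWFExist_holds)

/-- **Discharge of the named fact `secureSignaturesExist_of_secureSKEExist`** (`Schemes.lean`):
Corollary of crypto-foundations.S13 and crypto-foundations.S23: secure private-key encryption
implies secure signatures (via one-way functions). [Impagliazzo–Luby 1989, Thm. 1; Rompel
1990] — obtained as `secureSignaturesExist_of_secureSKEExist_of_OWF` applied to the tree's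
unconditional discharge `PRGExist_iff_OWFExist_holds)` of its hypothesis (reduction in
`SchemesSKESignatures.lean`).
[cite: ImpagliazzoLuby1989, Thm. 1] -/
theorem secureSignaturesExist_of_secureSKEExist_holds :
    secureSignaturesExist_of_secureSKEExist :=
  secureSignaturesExist_of_secureSKEExist_of_OWF
    (Literature.Computability.Cryptography.secureSignaturesExist_of_OWFExist_of_HILL Literature.Computability.Cryptography.PRGExist_iff_OWFExist_holds)

end Literature.Computability.Cryptography
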